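import Summits.BirchSwinnertonDyer.BirchSwinnertonDyer.Theses.PAdicOrder
import Summits.BirchSwinnertonDyer.BirchSwinnertonDyer.Theses.PAdicOrderV2
import Summits.BirchSwinnertonDyer.BirchSwinnertonDyer.Theses.LeadingTerm
import Summits.BirchSwinnertonDyer.BirchSwinnertonDyer.Theses.SelmerRank
import Summits.BirchSwinnertonDyer.BirchSwinnertonDyer.Theses.Squeeze
import Summits.BirchSwinnertonDyer.BirchSwinnertonDyer.Theses.HigherGrossZagier
import Summits.BirchSwinnertonDyer.BirchSwinnertonDyer.Theorems.LeadingTermConsistencyLocusSplit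
import Summits.BirchSwinnertonDyer.BirchSwinnertonDyer.Theorems.LeadingTermLBOfCruxes
import Literature.NumberTheory.EllipticCurves.PAdicBSD
import Literature.NumberTheory.EllipticCurves.IwasawaLeadingTerm
import Literature.NumberTheory.EllipticCurves.KatoRankBoundProofs
import Literature.NumberTheory.EllipticCurves.IwasawaSelmerDualProofs
import Literature.NumberTheory.EllipticCurves.SelmerInftyTorsionFiniteProofs
import Literature.NumberTheory.EllipticCurves.CanonicalPAdicHeightHolds
import Literature.NumberTheory.EllipticCurves.ModPIrreducibleCofinite
import Literature.NumberTheory.EllipticCurves.OrdinaryPrimesProofs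
import Literature.NumberTheory.EllipticCurves.LeadingTermProofs

/-!
# BirchSwinnertonDyer / PAdicOrderV2 — crux `PAdicOrderThesisR2` (stmt-BirchSwinnertonDyer-0487),
# line `lambda-adic-gz-square-class`: the HOMES of the bare residual stub R `stub_residualSectors`

Helper file (`--supports stmt-BirchSwinnertonDyer-0487`) for the lead skeleton
`Cruxes/PAdicOrderThesisR2/Lines/lambda_adic_gz_square_class.lean`, whose stub R
`stub_residualSectors` is BARE by design: on analytic rank `≥ 2` outside the non-CM rank-2 sector,
(rank) `rank_ℤ E(ℚ) = r_an` and (J) ONE good ordinary `p ≥ 5` with `E[p]` irreducible,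
`Ш(E/ℚ)[p^∞]` finite and every canonical cyclotomic height datum non-degenerate. Recorded here,
sorry-free and with R's registered signature VERBATIM as the conclusion, are R's item-level HOMES:

* `stub_residualSectors_of_routeItems` — R ⟸ the bet route's cruxes #2 `PAdicOrderComparisonR2`
  (stmt-0489), #3 `PAdicOrderPadicBSDrankR2` (stmt-0490), #8 `KatoDivisibility` (stmt-18082, in
  print), modulo modularity `exists_isNewformOf` and Perrin-Riou–Schneider
  `Schneider1985_order_charGenerator` (facts of the skeleton's stub F). (J): #3 at a LARGE good
  ordinary prime with `E[p]` irreducible (`exists_gt_mem_goodOrdinaryPrimes_hasIrreducibleModPGaloisRep`,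
  PROVED) and the pointwise converter `schneiderSha_of_orderEqRank_katoDivisibility` (Kato in the
  ITEM's two-clause shape + PRS: `r_MW ≤ ord f_E ≤ ord L_p = r_MW`, then PRS clause 2).
* `stub_residualSectors_of_items` — R ⟸ `Squeeze.SqueezeUBR2` (0496) ∧ `SqueezeLBplusOne` (0144) ∧
  `SqueezeParity` (0146) ∧ `SelmerRank.SelmerRankShaPFinite` (0132: `Ш[p^∞]` finite, all `E`, all
  `p`) ∧ `PAdicOrder.PAdicOrderSchneiderR8` (0536: Schneider proper at every good ordinary `p ≥ 5`;
  ledger status closed/parked, decl live in `Theses/PAdicOrder.lean`) — NO named fact.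
* `stub_residualSectors_of_higherGZItems` — the same with the rank from `HigherGZConstructionR2`
  (0501) ∧ `HigherGrossZagier.SqueezeUBR2` (0496), junk-robustly (no modularity), as in that
  route's certified `closes`.
* `stub_residualSectors_of_leadingTermItems` — R ⟸ LeadingTerm's `Consistency` (16217) ∧
  `PinchPrime` (16218) ∧ `SqueezeUBR2` (0145) PLUS `PAdicOrderSchneiderR8`, modulo PRS and the
  ∀-closure of the Literature fact `kato_divisibility` (the hypotheses of the landed
  `shaTransfer_of_consistency_of_facts`): Schneider at an irreducible prime is the only input beyond
  LeadingTerm's items; `Ш[p^∞]`-finiteness there follows by the `∞ → p` transfer.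

NECESSITY / the gap: `residualSectorsMinus_of_bsd_pinchPrime` — BSD-rank(gm) ∧ `PinchPrime` (= the
thesis with its prime `≥ 5`, `thesisFiveLe_iff_bsd_and_pinchPrime`, p134995) give, modulo PRS and
the Kato item, R MINUS `W.HasIrreducibleModPGaloisRep p`. Irreducibility at the witness is NOT
recovered (the pinch prime may be one of E's finitely many reducible primes; nothing landed moves
Schneider / `Ш[p^∞]`-finiteness between primes), so R's (J)-half has no `∃p` item home: its homes
are the `∀p` items #3 / stmt-0132 ∧ stmt-0536, each of summit size. Nothing is asserted
unconditionally. (Kato 2004 Thm. 17.4; BMS 2016 Thm. 1.7; MTT 1986 §II.10; MST 2006 Conj. 1.1.)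
-/

noncomputable section

-- single-conjunct summit: `Summit.BirchSwinnertonDyer.BirchSwinnertonDyer.…` repeats the name by design
set_option linter.dupNamespace false

namespace Summit.BirchSwinnertonDyer.BirchSwinnertonDyer.Cruxes.PAdicOrderThesisR2.LambdaAdicGZ

open scoped MatrixGroups ModularForm
open CongruenceSubgroup
open Literature.NumberTheory.EllipticCurves Literature.NumberTheory.EllipticCurves.ModularForms
open Summit.BirchSwinnertonDyer.BirchSwinnertonDyer.Theses

/-! ## The pointwise converter at one prime: Kato's divisibility (item shape) + PRS -/
/-- **Order bookkeeping for Kato's divisibility in the two-clause (item) shape.** If `g` lies in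
the principal ideal `(f_E)` of `Λ = ℤ_p⟦T⟧` and `ι g = p^n · L` in `ℚ_p⟦T⟧`, then
`ord_T f_E ≤ ord_T L`: `ord f_E ≤ ord (a f_E) ≤ ord ι(a f_E) = ord (p^n L) = ord L`.
[cite: Kato2004Asterisque, Thm. 17.4 (p. 273)] -/
theorem order_le_order_of_mem_span_of_map_eq (p : ℕ) [Fact p.Prime] {fE g : IwasawaAlgebra p}
    {n : ℕ} {L : PowerSeries ℚ_[p]} (hg : g ∈ Ideal.span {fE})
    (hι : iwasawaToPowerSeries p g = PowerSeries.C ((p : ℚ_[p]) ^ n) * L) :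
    fE.order ≤ L.order := by
  obtain ⟨a, rfl⟩ := Ideal.mem_span_singleton'.mp hg
  have h1 : fE.order ≤ (a * fE).order :=
    le_trans (by simp) (PowerSeries.le_order_mul a fE)
  have h2 : (a * fE).order ≤ (iwasawaToPowerSeries p (a * fE)).order :=
    PowerSeries.le_order_map _
  have hpn : IsUnit (PowerSeries.C ((p : ℚ_[p]) ^ n)) := by
    refine IsUnit.map PowerSeries.C (IsUnit.mk0 _ (pow_ne_zero n ?_))
    exact_mod_cast (Fact.out : p.Prime).ne_zero
  have h3 : (iwasawaToPowerSeries p (a * fE)).order = L.order := by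
    rw [hι, PowerSeries.order_mul, PowerSeries.order_zero_of_unit hpn, zero_add]
  exact h3 ▸ h1.trans h2

/-- **`ord_T L_p = r_MW` at a good ordinary `p ≥ 5` forces `Ш(E/ℚ)[p^∞]` finite AND Schneider
non-degeneracy of every canonical height datum at `p`**, modulo Perrin-Riou–Schneider (`hPRS`,
Balakrishnan–Müller–Stein 2016 Thm. 1.7) and Kato's divisibility in the shape of the route ITEM
`PAdicOrderV2.KatoDivisibility` (stmt-BirchSwinnertonDyer-18082; Kato 2004 Thm. 17.4 (1)–(2)) — no
main conjecture, no irreducibility: on the cyclotomic datum, the (finitely generated) Iwasawa datum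
and a generator `f_E` of `char X`, `r_MW ≤ ord f_E` (PRS clause 1 at the canonical datum of
`exists_isCanonical_holds`) and `ord f_E ≤ ord L_p = r_MW` (Kato), so `ord f_E = r_MW` and PRS
clause 2 converts. (From the THREE-clause Literature fact `kato_divisibility` this is the landed
`stub_schneiderSha_of_pinchAt_kato`, p139782.)
[cite: BalakrishnanMullerStein2015, Thm. 1.7] [cite: Kato2004Asterisque, Thm. 17.4 (p. 273)] -/
theorem schneiderSha_of_orderEqRank_katoDivisibility
    (hPRS : Schneider1985_order_charGenerator) (hK : PAdicOrderV2.KatoDivisibility)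
    (W : WeierstrassCurve ℚ) [W.IsElliptic] [W.IsGloballyMinimal] (p : ℕ) [Fact p.Prime]
    {N : ℕ} [NeZero N] (f : CuspForm (Gamma0 N) 2)
    (h5 : 5 ≤ p) (hord : IsOrdinaryAt W p) (hf : IsNewformOf W f)
    (horder : (padicLFunction f (unitRoot W p : ℚ_[p])).order = W.mordellWeilRank) :
    Finite (AddCommGroup.primaryComponent W.sha p) ∧
      ∀ Dh : WeierstrassCurve.PAdicHeightData W p, Dh.IsCanonical →
        WeierstrassCurve.SchneiderConjecture Dh := by
  obtain ⟨κ, hκ, γ, hγ, hγ'⟩ := exists_isCyclotomic_isTopGenerator_isCyclotomicVariable_holds p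
  obtain ⟨D⟩ := W.nonempty_selmerDualData_holds κ γ hγ
  haveI : Module.Finite (IwasawaAlgebra p) D.X := D.module_finite_of_isCyclotomic W κ hκ hγ
  obtain ⟨fE, hfE⟩ : ∃ fE : IwasawaAlgebra p, D.charIdeal = Ideal.span {fE} := by
    have hP : (D.charIdeal).IsPrincipal := charIdeal_isPrincipal_holds p D.X
    exact ⟨hP.generator, (Ideal.span_singleton_generator D.charIdeal).symm⟩
  -- Kato (item shape): `X` torsion, `g ∈ char X = (f_E)`, `ι g = p^n L_p`
  obtain ⟨hX, n, g, hg, hιg⟩ := hK W p (by omega) hord κ γ hκ hγ hγ' f hf D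
  rw [hfE] at hg
  have hle : fE.order ≤ (W.mordellWeilRank : ℕ∞) :=
    horder ▸ order_le_order_of_mem_span_of_map_eq p hg hιg
  -- PRS clause 1 at the canonical datum: `r_MW ≤ ord f_E`
  obtain ⟨Dh₀, hDh₀⟩ := WeierstrassCurve.exists_isCanonical_holds W p h5 hord.1 hord.2
  have hge : (W.mordellWeilRank : ℕ∞) ≤ fE.order :=
    Schneider1985_order_charGenerator.mordellWeilRank_le_order hPRS h5 hord.1 hord.2 hκ hγ hγ' D
      hX hfE hDh₀
  have heq : fE.order = W.mordellWeilRank := le_antisymm hle hge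
  -- PRS clause 2 converts, at `Dh₀` for `Ш` and at every canonical `Dh` for Schneider
  refine ⟨((Schneider1985_order_charGenerator.order_eq_iff hPRS h5 hord.1 hord.2 hκ hγ hγ' D hX
    hfE hDh₀).mp heq).2, fun Dh hDh ↦ ?_⟩
  exact ((Schneider1985_order_charGenerator.order_eq_iff hPRS h5 hord.1 hord.2 hκ hγ hγ' D hX
    hfE hDh).mp heq).1

/-! ## The (J) half of R from existing items -/
/-- **(J) for EVERY curve from the route's cruxes #3 and #8** (modulo modularity and PRS, facts of
the skeleton's stub F): if `PAdicOrderV2.PAdicOrderPadicBSDrankR2` (stmt-0490: `ord_T L_p = r_MW` at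
every good ordinary prime, every newform) and `PAdicOrderV2.KatoDivisibility` (stmt-18082) hold,
then every elliptic `E/ℚ` (globally minimal `W`) has a good ordinary `p ≥ 5` with `E[p]`
irreducible, `Ш(E/ℚ)[p^∞]` finite and every canonical height datum non-degenerate: take a good
ordinary `p > 4` with `E[p]` irreducible (`exists_gt_mem_goodOrdinaryPrimes_hasIrreducibleModPGaloisRep`,
PROVED: infinitely many good ordinary primes, finitely many reducible ones), the newform of
modularity, and `schneiderSha_of_orderEqRank_katoDivisibility`. No analytic-rank hypothesis.
[cite: SilvermanAEC2009, Cor. IX.6.3] [cite: BalakrishnanMullerStein2015, Thm. 1.7] -/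
theorem samePrimeJ_of_padicBSDrank_katoDivisibility
    (hmod : exists_isNewformOf) (hPRS : Schneider1985_order_charGenerator)
    (h3 : PAdicOrderV2.PAdicOrderPadicBSDrankR2) (hK : PAdicOrderV2.KatoDivisibility)
    (W : WeierstrassCurve ℚ) [W.IsElliptic] [W.IsGloballyMinimal] :
    ∃ (p : ℕ) (_ : Fact p.Prime), 5 ≤ p ∧ IsOrdinaryAt W p ∧ W.HasIrreducibleModPGaloisRep p ∧
      Finite (AddCommGroup.primaryComponent W.sha p) ∧
      ∀ Dh : WeierstrassCurve.PAdicHeightData W p, Dh.IsCanonical →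
        WeierstrassCurve.SchneiderConjecture Dh := by
  haveI : NeZero (W.conductorNorm ℤ) := ⟨(WeierstrassCurve.conductorNorm_pos_holds (W := W)).ne'⟩
  obtain ⟨f, hf⟩ := hmod W
  obtain ⟨p, h4, ⟨hp, hgood, hnd⟩, hirr⟩ :=
    W.exists_gt_mem_goodOrdinaryPrimes_hasIrreducibleModPGaloisRep 4
  haveI : Fact p.Prime := hp
  have hO : IsOrdinaryAt W p := ⟨hgood, hnd⟩
  have key := schneiderSha_of_orderEqRank_katoDivisibility hPRS hK W p f (by omega) hO hf
    (h3 W p hO f hf)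
  exact ⟨p, hp, by omega, hO, hirr, key.1, key.2⟩

/-- **(J) for EVERY curve from the two `∀p` items, fact-free**: `SelmerRank.SelmerRankShaPFinite`
(stmt-0132: `Ш(E/ℚ)[p^∞]` finite for every elliptic `W/ℚ` and every prime `p`) and
`PAdicOrder.PAdicOrderSchneiderR8` (stmt-0536: Schneider's conjecture proper — every canonical
cyclotomic height datum non-degenerate at every good ordinary `p ≥ 5`) give (J) at any good
ordinary `p ≥ 5` with `E[p]` irreducible, which exists
(`exists_gt_mem_goodOrdinaryPrimes_hasIrreducibleModPGaloisRep`). [cite: MazurSteinTate2006, Conj. 1.1]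
[cite: SilvermanAEC2009, Cor. IX.6.3] -/
theorem samePrimeJ_of_shaPFinite_schneiderR8
    (hSha : SelmerRank.SelmerRankShaPFinite) (hSch : PAdicOrder.PAdicOrderSchneiderR8)
    (W : WeierstrassCurve ℚ) [W.IsElliptic] [W.IsGloballyMinimal] :
    ∃ (p : ℕ) (_ : Fact p.Prime), 5 ≤ p ∧ IsOrdinaryAt W p ∧ W.HasIrreducibleModPGaloisRep p ∧
      Finite (AddCommGroup.primaryComponent W.sha p) ∧
      ∀ Dh : WeierstrassCurve.PAdicHeightData W p, Dh.IsCanonical →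
        WeierstrassCurve.SchneiderConjecture Dh := by
  obtain ⟨p, h4, ⟨hp, hgood, hnd⟩, hirr⟩ :=
    W.exists_gt_mem_goodOrdinaryPrimes_hasIrreducibleModPGaloisRep 4
  haveI : Fact p.Prime := hp
  exact ⟨p, hp, by omega, ⟨hgood, hnd⟩, hirr, hSha W p,
    fun Dh hDh ↦ hSch W p (by omega) hgood hnd Dh hDh⟩

/-- **(J) for EVERY curve from LeadingTerm's `Consistency ∧ PinchPrime` plus Schneider proper**,
modulo PRS and the ∀-closure of the Literature fact `kato_divisibility` (Kato 2004 Thm. 17.4; the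
hypotheses of the landed `Theorems.shaTransfer_of_consistency_of_facts`): at a good ordinary
`p ≥ 5` with `E[p]` irreducible, Schneider holds by `PAdicOrder.PAdicOrderSchneiderR8` (stmt-0536),
`L^{(r_MW)}(E,1) ≠ 0` by the closed support `LBOfCruxes` (stmt-15623, `leadingTerm_lbOfCruxes_proof`),
and the `∞ → p` Ш-transfer of `Consistency` gives `Ш(E/ℚ)[p^∞]` finite; the newform is the one
`PinchPrime` carries (no modularity). [cite: Kato2004Asterisque, Thm. 17.4 (p. 273)] -/
theorem samePrimeJ_of_leadingTerm_schneiderR8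
    (hPRS : Schneider1985_order_charGenerator)
    (hkato : ∀ (W : WeierstrassCurve ℚ) [W.IsElliptic] [W.IsGloballyMinimal] (p : ℕ) [Fact p.Prime]
      (κ : ZpExtension ℚ p) (γ : Field.absoluteGaloisGroup ℚ) {N : ℕ} [NeZero N]
      (f : CuspForm (Gamma0 N) 2), kato_divisibility W p (κ := κ) (γ := γ) (f := f))
    (hC : LeadingTerm.Consistency) (hP : LeadingTerm.PinchPrime)
    (hSch : PAdicOrder.PAdicOrderSchneiderR8)
    (W : WeierstrassCurve ℚ) [W.IsElliptic] [W.IsGloballyMinimal] :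
    ∃ (p : ℕ) (_ : Fact p.Prime), 5 ≤ p ∧ IsOrdinaryAt W p ∧ W.HasIrreducibleModPGaloisRep p ∧
      Finite (AddCommGroup.primaryComponent W.sha p) ∧
      ∀ Dh : WeierstrassCurve.PAdicHeightData W p, Dh.IsCanonical →
        WeierstrassCurve.SchneiderConjecture Dh := by
  -- the newform carried by the pinch prime (its prime is not used)
  obtain ⟨-, -, -, -, -, -, N, hN, f, hf, -⟩ := hP W
  obtain ⟨p, h4, ⟨hp, hgood, hnd⟩, hirr⟩ :=
    W.exists_gt_mem_goodOrdinaryPrimes_hasIrreducibleModPGaloisRep 4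
  haveI : Fact p.Prime := hp
  have h5 : 5 ≤ p := by omega
  have hO : IsOrdinaryAt W p := ⟨hgood, hnd⟩
  have hSchp : ∀ Dh : WeierstrassCurve.PAdicHeightData W p, Dh.IsCanonical →
      WeierstrassCurve.SchneiderConjecture Dh := fun Dh hDh ↦ hSch W p h5 hgood hnd Dh hDh
  obtain ⟨Dh₀, hDh₀⟩ := WeierstrassCurve.exists_isCanonical_holds W p h5 hgood hnd
  have hL : iteratedDeriv W.mordellWeilRank W.entireLFunction 1 ≠ 0 :=
    Theorems.leadingTerm_lbOfCruxes_proof hC hP W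
  have hsha : Finite (AddCommGroup.primaryComponent W.sha p) :=
    Theorems.shaTransfer_of_consistency_of_facts hPRS hkato hC W p h5 hO Dh₀ hDh₀ f hf hL
      (hSchp Dh₀ hDh₀)
  exact ⟨p, hp, h5, hO, hirr, hsha, hSchp⟩

/-! ## The rank half of R from existing items -/
/-- **BSD-rank(gm) from the route's cruxes #2 and #3** (modulo modularity): at any good ordinary
prime (`exists_good_ordinary_prime_holds`, PROVED) and the newform of `E`,
`ord_T L_p = r_an` (`PAdicOrderV2.PAdicOrderComparisonR2`, stmt-0489) and `ord_T L_p = r_MW`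
(`PAdicOrderV2.PAdicOrderPadicBSDrankR2`, stmt-0490), and `ℕ → ℕ∞` is injective.
[cite: MazurTateTeitelbaum1986Invent, §II.10] -/
theorem mordellWeilRank_eq_analyticRank_of_comparison_padicBSDrank
    (hmod : exists_isNewformOf) (h2 : PAdicOrderV2.PAdicOrderComparisonR2)
    (h3 : PAdicOrderV2.PAdicOrderPadicBSDrankR2)
    (W : WeierstrassCurve ℚ) [W.IsElliptic] [W.IsGloballyMinimal] :
    W.mordellWeilRank = W.analyticRank := by
  haveI : NeZero (W.conductorNorm ℤ) := ⟨(WeierstrassCurve.conductorNorm_pos_holds (W := W)).ne'⟩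
  obtain ⟨f, hf⟩ := hmod W
  obtain ⟨p, hp, -, hgood, hnd⟩ := WeierstrassCurve.exists_good_ordinary_prime_holds W
  have hO : IsOrdinaryAt W p := ⟨hgood, hnd⟩
  exact_mod_cast (h3 W p hO f hf).symm.trans (h2 W p hO f hf)

/-- **BSD-rank from the three Squeeze cruxes** `Squeeze.SqueezeUBR2` (stmt-0496),
`Squeeze.SqueezeLBplusOne` (stmt-0144), `Squeeze.SqueezeParity` (stmt-0146), through route
Squeeze's certified deciding theorem `Squeeze.closes` (`r_an = r_MW + 1` has the wrong parity).
[folklore] -/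
theorem mordellWeilRank_eq_analyticRank_of_squeeze
    (hUB : Squeeze.SqueezeUBR2) (hLB1 : Squeeze.SqueezeLBplusOne) (hpar : Squeeze.SqueezeParity)
    (W : WeierstrassCurve ℚ) [W.IsElliptic] : W.mordellWeilRank = W.analyticRank :=
  (Squeeze.closes hUB hLB1 hpar W ‹_›).symm

/-- **BSD-rank in analytic rank `≥ 2` from `HigherGZConstructionR2 ∧ SqueezeUBR2`** (stmt-0501 ∧
stmt-0496), with NO modularity hypothesis: the construction gives `r_an` points whose Gram
determinant is `L^{(r)}(E,1)/(r!·c) ≠ 0` (junk-robust: `leadingLCoeff_ne_zero_of_analyticRank_ne_zero`,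
a genuine zero of positive finite order has non-zero leading coefficient), so `r_an ≤ r_MW` by the
Gram lemma (`Literature.EllArith.gram_lemma` with the proved Mordell–Weil theorem
`module_finite_point_holds` and `heightPairing_add_left_holds`), as in HigherGrossZagier's certified
`closes`; `SqueezeUBR2` is the other inequality. [folklore] -/
theorem mordellWeilRank_eq_analyticRank_of_higherGZ
    (hGZ : HigherGrossZagier.HigherGZConstructionR2) (hUB : HigherGrossZagier.SqueezeUBR2)
    (W : WeierstrassCurve ℚ) [W.IsElliptic] (h2 : 2 ≤ W.analyticRank) :
    W.mordellWeilRank = W.analyticRank := by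
  obtain ⟨P, c, _hc, hL⟩ := hGZ W h2
  have hne : W.leadingLCoeff ≠ 0 := leadingLCoeff_ne_zero_of_analyticRank_ne_zero W (by omega)
  have hdet : (Matrix.of fun i j => (P i).heightPairing (P j)).det ≠ 0 := by
    intro h0
    apply hne
    rw [hL, h0, mul_zero, Complex.ofReal_zero]
  have hLB : W.analyticRank ≤ W.mordellWeilRank :=
    Literature.EllArith.gram_lemma W (WeierstrassCurve.module_finite_point_holds W)
      WeierstrassCurve.Affine.Point.heightPairing_add_left_holds W.analyticRank P hdet
  exact le_antisymm (hUB W) hLB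

/-! ## The wirings: R's registered signature, verbatim, from existing items -/
/-- **Combinator**: R (registered signature verbatim) from a rank statement and (J), both on
analytic rank `≥ 2` (the CM / rank-`≥ 3` restriction of R is simply dropped). [folklore] -/
theorem stub_residualSectors_of_rank_of_samePrimeJ
    (hrank : ∀ (W : WeierstrassCurve ℚ) [W.IsElliptic] [W.IsGloballyMinimal], 2 ≤ W.analyticRank →
      W.mordellWeilRank = W.analyticRank)
    (hJ : ∀ (W : WeierstrassCurve ℚ) [W.IsElliptic] [W.IsGloballyMinimal], 2 ≤ W.analyticRank →
      ∃ (p : ℕ) (_ : Fact p.Prime), 5 ≤ p ∧ IsOrdinaryAt W p ∧ W.HasIrreducibleModPGaloisRep p ∧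
        Finite (AddCommGroup.primaryComponent W.sha p) ∧
        ∀ Dh : WeierstrassCurve.PAdicHeightData W p, Dh.IsCanonical →
          WeierstrassCurve.SchneiderConjecture Dh) :
    ∀ (W : WeierstrassCurve ℚ) [W.IsElliptic] [W.IsGloballyMinimal], 2 ≤ W.analyticRank →
      (W.analyticRank = 2 → W.HasCM) →
      W.mordellWeilRank = W.analyticRank ∧
        ∃ (p : ℕ) (_ : Fact p.Prime), 5 ≤ p ∧ IsOrdinaryAt W p ∧ W.HasIrreducibleModPGaloisRep p ∧
          Finite (AddCommGroup.primaryComponent W.sha p) ∧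
          ∀ Dh : WeierstrassCurve.PAdicHeightData W p, Dh.IsCanonical →
            WeierstrassCurve.SchneiderConjecture Dh :=
  fun W _ _ h2 _ ↦ ⟨hrank W h2, hJ W h2⟩

/-- **R ⟸ the bet route's own cruxes #2, #3, #8** (modulo modularity and PRS, named facts of the
skeleton's stub F): `exists_isNewformOf → Schneider1985_order_charGenerator →
PAdicOrderComparisonR2 (stmt-0489) → PAdicOrderPadicBSDrankR2 (stmt-0490) → KatoDivisibility
(stmt-18082) →` the registered signature of `stub_residualSectors`. Rank by
`mordellWeilRank_eq_analyticRank_of_comparison_padicBSDrank`, (J) by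
`samePrimeJ_of_padicBSDrank_katoDivisibility`. [cite: MazurTateTeitelbaum1986Invent, §II.10]
[cite: Kato2004Asterisque, Thm. 17.4 (p. 273)] -/
theorem stub_residualSectors_of_routeItems :
    exists_isNewformOf → Schneider1985_order_charGenerator →
    PAdicOrderV2.PAdicOrderComparisonR2 → PAdicOrderV2.PAdicOrderPadicBSDrankR2 →
    PAdicOrderV2.KatoDivisibility →
    ∀ (W : WeierstrassCurve ℚ) [W.IsElliptic] [W.IsGloballyMinimal], 2 ≤ W.analyticRank →
      (W.analyticRank = 2 → W.HasCM) →
      W.mordellWeilRank = W.analyticRank ∧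
        ∃ (p : ℕ) (_ : Fact p.Prime), 5 ≤ p ∧ IsOrdinaryAt W p ∧ W.HasIrreducibleModPGaloisRep p ∧
          Finite (AddCommGroup.primaryComponent W.sha p) ∧
          ∀ Dh : WeierstrassCurve.PAdicHeightData W p, Dh.IsCanonical →
            WeierstrassCurve.SchneiderConjecture Dh :=
  fun hmod hPRS h2 h3 hK ↦ stub_residualSectors_of_rank_of_samePrimeJ
    (fun W _ _ _ ↦ mordellWeilRank_eq_analyticRank_of_comparison_padicBSDrank hmod h2 h3 W)
    (fun W _ _ _ ↦ samePrimeJ_of_padicBSDrank_katoDivisibility hmod hPRS h3 hK W)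

/-- **R ⟸ sibling items only, NO named fact**: `Squeeze.SqueezeUBR2 (stmt-0496) →
Squeeze.SqueezeLBplusOne (stmt-0144) → Squeeze.SqueezeParity (stmt-0146) →
SelmerRank.SelmerRankShaPFinite (stmt-0132) → PAdicOrder.PAdicOrderSchneiderR8 (stmt-0536) →`
the registered signature of `stub_residualSectors`. [cite: MazurSteinTate2006, Conj. 1.1] -/
theorem stub_residualSectors_of_items :
    Squeeze.SqueezeUBR2 → Squeeze.SqueezeLBplusOne → Squeeze.SqueezeParity →
    SelmerRank.SelmerRankShaPFinite → PAdicOrder.PAdicOrderSchneiderR8 →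
    ∀ (W : WeierstrassCurve ℚ) [W.IsElliptic] [W.IsGloballyMinimal], 2 ≤ W.analyticRank →
      (W.analyticRank = 2 → W.HasCM) →
      W.mordellWeilRank = W.analyticRank ∧
        ∃ (p : ℕ) (_ : Fact p.Prime), 5 ≤ p ∧ IsOrdinaryAt W p ∧ W.HasIrreducibleModPGaloisRep p ∧
          Finite (AddCommGroup.primaryComponent W.sha p) ∧
          ∀ Dh : WeierstrassCurve.PAdicHeightData W p, Dh.IsCanonical →
            WeierstrassCurve.SchneiderConjecture Dh :=
  fun hUB hLB1 hpar hSha hSch ↦ stub_residualSectors_of_rank_of_samePrimeJ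
    (fun W _ _ _ ↦ mordellWeilRank_eq_analyticRank_of_squeeze hUB hLB1 hpar W)
    (fun W _ _ _ ↦ samePrimeJ_of_shaPFinite_schneiderR8 hSha hSch W)

/-- **R ⟸ HigherGrossZagier ∧ the two `∀p` items, NO named fact**:
`HigherGrossZagier.HigherGZConstructionR2 (stmt-0501) → HigherGrossZagier.SqueezeUBR2 (stmt-0496) →
SelmerRank.SelmerRankShaPFinite (stmt-0132) → PAdicOrder.PAdicOrderSchneiderR8 (stmt-0536) →` the
registered signature of `stub_residualSectors`. [cite: MazurSteinTate2006, Conj. 1.1] -/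
theorem stub_residualSectors_of_higherGZItems :
    HigherGrossZagier.HigherGZConstructionR2 → HigherGrossZagier.SqueezeUBR2 →
    SelmerRank.SelmerRankShaPFinite → PAdicOrder.PAdicOrderSchneiderR8 →
    ∀ (W : WeierstrassCurve ℚ) [W.IsElliptic] [W.IsGloballyMinimal], 2 ≤ W.analyticRank →
      (W.analyticRank = 2 → W.HasCM) →
      W.mordellWeilRank = W.analyticRank ∧
        ∃ (p : ℕ) (_ : Fact p.Prime), 5 ≤ p ∧ IsOrdinaryAt W p ∧ W.HasIrreducibleModPGaloisRep p ∧
          Finite (AddCommGroup.primaryComponent W.sha p) ∧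
          ∀ Dh : WeierstrassCurve.PAdicHeightData W p, Dh.IsCanonical →
            WeierstrassCurve.SchneiderConjecture Dh :=
  fun hGZ hUB hSha hSch ↦ stub_residualSectors_of_rank_of_samePrimeJ
    (fun W _ _ h2 ↦ mordellWeilRank_eq_analyticRank_of_higherGZ hGZ hUB W h2)
    (fun W _ _ _ ↦ samePrimeJ_of_shaPFinite_schneiderR8 hSha hSch W)

/-- **R ⟸ LeadingTerm's three cruxes plus Schneider proper** (modulo PRS and the ∀-closure of
`kato_divisibility`, the hypotheses of the landed `shaTransfer_of_consistency_of_facts`):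
`Consistency (16217) → PinchPrime (16218) → LeadingTerm.SqueezeUBR2 (0145) →
PAdicOrder.PAdicOrderSchneiderR8 (0536) →` R. Rank through LeadingTerm's certified `closes`; so on
the LeadingTerm side the only input R needs beyond the route's items is Schneider non-degeneracy
at ONE irreducible good ordinary prime. [cite: Kato2004Asterisque, Thm. 17.4 (p. 273)] -/
theorem stub_residualSectors_of_leadingTermItems
    (hPRS : Schneider1985_order_charGenerator)
    (hkato : ∀ (W : WeierstrassCurve ℚ) [W.IsElliptic] [W.IsGloballyMinimal] (p : ℕ) [Fact p.Prime]
      (κ : ZpExtension ℚ p) (γ : Field.absoluteGaloisGroup ℚ) {N : ℕ} [NeZero N]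
      (f : CuspForm (Gamma0 N) 2), kato_divisibility W p (κ := κ) (γ := γ) (f := f)) :
    LeadingTerm.Consistency → LeadingTerm.PinchPrime → LeadingTerm.SqueezeUBR2 →
    PAdicOrder.PAdicOrderSchneiderR8 →
    ∀ (W : WeierstrassCurve ℚ) [W.IsElliptic] [W.IsGloballyMinimal], 2 ≤ W.analyticRank →
      (W.analyticRank = 2 → W.HasCM) →
      W.mordellWeilRank = W.analyticRank ∧
        ∃ (p : ℕ) (_ : Fact p.Prime), 5 ≤ p ∧ IsOrdinaryAt W p ∧ W.HasIrreducibleModPGaloisRep p ∧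
          Finite (AddCommGroup.primaryComponent W.sha p) ∧
          ∀ Dh : WeierstrassCurve.PAdicHeightData W p, Dh.IsCanonical →
            WeierstrassCurve.SchneiderConjecture Dh :=
  fun hC hP hUB hSch ↦ stub_residualSectors_of_rank_of_samePrimeJ
    (fun W _ _ _ ↦ (LeadingTerm.closes hC hP hUB W ‹_›).symm)
    (fun W _ _ _ ↦ samePrimeJ_of_leadingTerm_schneiderR8 hPRS hkato hC hP hSch W)

/-! ## Necessity: how much of R the thesis already forces (the irreducibility gap) -/
/-- **R minus irreducibility from BSD-rank(gm) ∧ `PinchPrime`** (modulo PRS and the Kato item):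
if `r_an = r_MW` for globally minimal models and `LeadingTerm.PinchPrime` (stmt-16218) holds — by
the landed normal form `thesisFiveLe_iff_bsd_and_pinchPrime` (p134995) this conjunction IS the
thesis `X` with its witness prime `≥ 5` — then every curve in R's range has `r_MW = r_an` and, AT
THE PINCH PRIME (good ordinary, `≥ 5`), `Ш(E/ℚ)[p^∞]` finite and every canonical height datum
non-degenerate. NOT obtained: `W.HasIrreducibleModPGaloisRep p` there (the pinch prime may be one
of E's finitely many reducible primes; nothing landed transfers the pair between primes) — the
exact gap between R and what every proof of `X` must contain; at an irreducible pinch prime the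
same term gives R's conclusion at `W` outright.
[cite: BalakrishnanMullerStein2015, Thm. 1.7] [cite: Kato2004Asterisque, Thm. 17.4 (p. 273)] -/
theorem residualSectorsMinus_of_bsd_pinchPrime
    (hPRS : Schneider1985_order_charGenerator) (hK : PAdicOrderV2.KatoDivisibility)
    (hBSD : ∀ (W : WeierstrassCurve ℚ) [W.IsElliptic] [W.IsGloballyMinimal],
      W.analyticRank = W.mordellWeilRank)
    (hP : LeadingTerm.PinchPrime) :
    ∀ (W : WeierstrassCurve ℚ) [W.IsElliptic] [W.IsGloballyMinimal], 2 ≤ W.analyticRank →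
      (W.analyticRank = 2 → W.HasCM) →
      W.mordellWeilRank = W.analyticRank ∧
        ∃ (p : ℕ) (_ : Fact p.Prime), 5 ≤ p ∧ IsOrdinaryAt W p ∧
          Finite (AddCommGroup.primaryComponent W.sha p) ∧
          ∀ Dh : WeierstrassCurve.PAdicHeightData W p, Dh.IsCanonical →
            WeierstrassCurve.SchneiderConjecture Dh := by
  intro W _ _ _ _
  obtain ⟨p, hp, h5, hord, -, -, N, hN, f, hf, horder⟩ := hP W
  exact ⟨(hBSD W).symm, p, hp, h5, hord,
    schneiderSha_of_orderEqRank_katoDivisibility hPRS hK W p f h5 hord hf horder⟩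

end Summit.BirchSwinnertonDyer.BirchSwinnertonDyer.Cruxes.PAdicOrderThesisR2.LambdaAdicGZ

end
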